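import Literature.Probability.RandomPlanarGeometry.LoewnerTransformContinuity
import Literature.Probability.Process.ExtendedContinuousMapping
import HarnessLib

/-!
# Loewner regularity and driving-process convergence of weak limits: curves in approximating domains

Topic `Literature/Probability/RandomPlanarGeometry` (family `crit-ising`); theorems only (no
definition, no named fact). Sequel of `DrivingProcessWeakLimit.lean` /
`LoewnerTransformContinuity.lean` (fixed domain) for random curves living in APPROXIMATING
domains `(D_n; a_n, b_n) → (D; a, b)`, each read through its own chordal uniformizing map
`φ_n : ℍ → D_n` — the setting of lattice interfaces: Chelkak–Duminil-Copin–Hongler–Kemppainen–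
Smirnov (C. R. Math. 352 (2014), §3, first lines: "consider a family of conformal maps `φ^δ`
from `Ω^δ` onto `ℍ` … we may assume that `φ^δ → φ` as `δ → 0`, uniformly on compact subsets";
Thm. 3: "`γ^δ ↦ w^δ`", the driving process of the discrete curve through the discrete map) and
Kemppainen–Smirnov (Ann. Probab. 45 (2017), §1.1: "a collection `Σ` of pairs `(φ, P)`";
Cor. 1.8: approximating domains).

* `tendsto_compactifiedClass_of_tendsto` — **the compactifications through converging maps
  converge along converging curves**: if `Φ_n → Φ` uniformly on the compacts
  `A ∩ closedBall 0 R` of a closed set `A ⊇` the curves' values, uniformly at infinity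
  (`dist (Φ_n z) b_n ≤ ε` for `‖z‖ ≥ r`, large `n`) with `b_n → b`, then for curves `γ_j → γ` of a
  uniformly bounded, uniformly transient family and indices `u j → ∞`,
  `⟦Φ_{u j} ∘ γ_j⟧ → ⟦Φ ∘ γ⟧` in the curve metric (the two-map version of
  `continuousOn_compactifiedClass`);
* `tendsto_snd_of_good_sequence` — for a compact box `𝒦` of Loewner pairs and uniformizing maps
  `φ_n`, `φ` whose boundary extensions converge in that sense: if `x_j = ⟦Φ_{u j} ∘ γ̂_j⟧` with
  `(γ̂_j, W_j) ∈ 𝒦` converge to `x`, then `x = ⟦Φ ∘ γ̂⟧` for some `(γ̂, W) ∈ 𝒦` (so `x` is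
  describable through `φ`) and `W_j → W(x)`, the Loewner transform of `x` through `φ`
  (compactness of `𝒦`, the previous item, uniqueness of limits and of driving functions) —
  exactly the "continuity along good sequences" consumed by the extended mapping theorem
  (`Process.tendstoInDistribution_comp_of_forall_exists_seq_tendsto`);
* **`ae_isLoewnerDescribable_and_tendstoInDistribution_drivingPath_varying`** — KS Thm. 1.5
  (ii)–(iii) / Cor. 1.7–1.8 for curve laws `μs n → ν` with `μs n` carried by curves of `D_n`:
  GIVEN (a) box tightness of the pull-backs through the `φ_n` (KS Prop. 3.2 for the family
  `(φ_n, μs n)`) and (b) the convergence of the boundary extensions `Φ_n → Φ` above (the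
  domain-approximation input; for uniformly convergent boundary loops it is Radó's theorem,
  `rado_tendstoUniformlyOn_holds`, up to normalisation), the weak limit `ν` is a.e. describable
  through `φ` and the discrete driving processes `W(φ_n⁻¹ γ)` under `μs n` converge in law to the
  driving function under `ν` — the clauses `hdesc`, `hlaw` of
  `LatticeModels.isSLELaw_three_of_subseqLimit_spinInterface_of_limitData` with the discrete
  drivers taken through the discrete uniformizers, as in CDHKS.

## References

* A. Kemppainen, S. Smirnov, Ann. Probab. 45 (2017) 698–779: Thm. 1.5, Cor. 1.7, Cor. 1.8,
  Prop. 3.2, §3.5 (arXiv:1212.6215: Thm. 1.3, Cor. 1.5, Cor. 1.6?, pp. 18–20). [KemppainenSmirnov2017]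
* D. Chelkak, H. Duminil-Copin, C. Hongler, A. Kemppainen, S. Smirnov, C. R. Math. Acad. Sci.
  Paris 352 (2014) 157–161, Thm. 3 and §3. [CDHKSCRAS2014]
* Ch. Pommerenke, *Boundary Behaviour of Conformal Maps* (1992), Thm. 2.11 (Radó). [PommerenkeBBCM1992]
-/

noncomputable section

open MeasureTheory Filter Topology Set Metric Bornology
open UpperHalfPlane (upperHalfPlaneSet)
open scoped NNReal ENNReal BoundedContinuousFunction unitInterval

namespace Literature.Probability.RandomPlanarGeometry

open scoped PathBorel

/-! ### Compactifications through converging maps -/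

section TwoMaps

variable {A : Set ℂ} {Φs : ℕ → ℂ → ℂ} {Φ : ℂ → ℂ} {bs : ℕ → ℂ} {b : ℂ}

/-- **Compactifications through converging maps converge along converging curves.** Let `A` be
closed; `Φ` continuous on `A` with limit `b` at infinity within `A`; `Φ_n` continuous on `A`
with limits `b_n` at infinity; `Φ_n → Φ` uniformly on every `A ∩ closedBall 0 R`; uniformly at
infinity, `dist (Φ_n z) b_n ≤ ε` for `z ∈ A`, `‖z‖ ≥ r(ε)` and large `n`; and `b_n → b`. Let `𝒮`
be a family of paths in `A`, uniformly bounded on compacts of time and uniformly transient. Then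
for `γ_j, γ ∈ 𝒮` with `γ_j → γ` locally uniformly and indices `u j → ∞`, the classes of the
compactified images converge: `⟦Φ_{u j} ∘ γ_j⟧ → ⟦Φ ∘ γ⟧`. [folklore] -/
theorem tendsto_compactifiedClass_of_tendsto (hA : IsClosed A) (hΦ : ContinuousOn Φ A)
    (hΦinf : Tendsto Φ (cocompact ℂ ⊓ 𝓟 A) (𝓝 b)) (hΦs : ∀ n, ContinuousOn (Φs n) A)
    (hΦsinf : ∀ n, Tendsto (Φs n) (cocompact ℂ ⊓ 𝓟 A) (𝓝 (bs n)))
    (hU1 : ∀ R : ℝ, TendstoUniformlyOn Φs Φ atTop (A ∩ closedBall 0 R))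
    (hU2 : ∀ ε : ℝ, 0 < ε → ∃ r : ℝ, ∀ᶠ n in atTop, ∀ z ∈ A, r ≤ ‖z‖ → dist (Φs n z) (bs n) ≤ ε)
    (hb : Tendsto bs atTop (𝓝 b)) {𝒮 : Set C(ℝ≥0, ℂ)} (h𝒮A : ∀ γ ∈ 𝒮, ∀ t, γ t ∈ A)
    (hbdd : ∀ T : ℝ≥0, ∃ R : ℝ, ∀ γ ∈ 𝒮, ∀ t ≤ T, ‖γ t‖ ≤ R)
    (htrans : ∀ r : ℝ, ∃ T : ℝ≥0, ∀ γ ∈ 𝒮, ∀ t, T ≤ t → r ≤ ‖γ t‖)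
    {γs : ℕ → C(ℝ≥0, ℂ)} {γ : C(ℝ≥0, ℂ)} (hγs : ∀ j, γs j ∈ 𝒮) (hγ : γ ∈ 𝒮)
    (hlim : Tendsto γs atTop (𝓝 γ)) {u : ℕ → ℕ} (hu : Tendsto u atTop atTop) :
    Tendsto (fun j ↦ compactifiedClass (Φs (u j)) (bs (u j)) (γs j)) atTop
      (𝓝 (compactifiedClass Φ b γ)) := by
  rw [Metric.tendsto_nhds]
  intro ε hε
  have hε8 : 0 < ε / 8 := by positivity
  -- far away: `Φ` close to `b`, `Φ_n` close to `b_n`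
  have hfar : ∃ r₁ : ℝ, ∀ z ∈ A, r₁ ≤ ‖z‖ → dist (Φ z) b < ε / 8 := by
    have h' : ∀ᶠ z in cocompact ℂ ⊓ 𝓟 A, dist (Φ z) b < ε / 8 :=
      Metric.tendsto_nhds.1 hΦinf (ε / 8) hε8
    rw [(hasBasis_cocompact.inf_principal _).eventually_iff] at h'
    obtain ⟨K, hK, hKε⟩ := h'
    obtain ⟨R, hR⟩ := hK.isBounded.subset_closedBall 0
    refine ⟨R + 1, fun z hzA hz ↦ hKε ⟨fun hzK ↦ ?_, hzA⟩⟩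
    have := mem_closedBall_zero_iff.1 (hR hzK)
    linarith
  obtain ⟨r₁, hr₁⟩ := hfar
  obtain ⟨r₂, hr₂⟩ := hU2 (ε / 8) hε8
  obtain ⟨T, hT⟩ := htrans (max r₁ r₂)
  obtain ⟨R, hR⟩ := hbdd T
  -- near: uniform continuity of `Φ` and uniform convergence `Φ_n → Φ` on `A ∩ closedBall 0 R`
  have hcpt : IsCompact (A ∩ closedBall (0 : ℂ) R) := (isCompact_closedBall 0 R).inter_left hA
  obtain ⟨η, hη, hηε⟩ := Metric.uniformContinuousOn_iff.1
    (hcpt.uniformContinuousOn_of_continuous (hΦ.mono inter_subset_left)) (ε / 8) hε8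
  have hU1' : ∀ᶠ n in atTop, ∀ z ∈ A ∩ closedBall (0 : ℂ) R, dist (Φ z) (Φs n z) < ε / 8 :=
    Metric.tendstoUniformlyOn_iff.1 (hU1 R) (ε / 8) hε8
  have hb' : ∀ᶠ n in atTop, dist (bs n) b < ε / 8 := Metric.tendsto_nhds.1 hb (ε / 8) hε8
  -- transfer to the index `j`
  have hj1 := hu.eventually hU1'
  have hj2 := hu.eventually hr₂
  have hj3 := hu.eventually hb'
  have hj4 : ∀ᶠ j in atTop, γs j ∈ Process.tube γ T η := hlim (Process.tube_mem_nhds γ T hη)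
  filter_upwards [hj1, hj2, hj3, hj4] with j h1 h2 h3 h4
  -- both classes are classes of genuine continuous curves
  obtain ⟨hc, -, hγeq⟩ := compactifiedClass_eq_mk_nodeValue (hΦs (u j)) (hΦsinf (u j))
    (h𝒮A _ (hγs j)) (tendsto_norm_atTop_of_transient htrans (hγs j))
  obtain ⟨hc₀, -, hγ₀eq⟩ := compactifiedClass_eq_mk_nodeValue hΦ hΦinf (h𝒮A γ hγ)
    (tendsto_norm_atTop_of_transient htrans hγ)
  rw [hγeq, hγ₀eq, CurveClass.dist_mk_mk]
  refine lt_of_le_of_lt ((Curve.dist_le_dist_toContinuousMap _ _).trans ?_) (half_lt_self hε)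
  rw [ContinuousMap.dist_le (half_pos hε).le]
  intro s
  change dist (nodeValue (Φs (u j)) (bs (u j)) (γs j) s) (nodeValue Φ b γ s) ≤ ε / 2
  by_cases hs : (s : ℝ) < 1
  · rw [nodeValue_of_lt _ _ _ hs, nodeValue_of_lt _ _ _ hs]
    set t : ℝ≥0 := rayParam s with ht
    by_cases htT : t ≤ T
    · have hzj : γs j t ∈ A ∩ closedBall (0 : ℂ) R :=
        ⟨h𝒮A _ (hγs j) t, mem_closedBall_zero_iff.2 (hR _ (hγs j) t htT)⟩
      have hz : γ t ∈ A ∩ closedBall (0 : ℂ) R :=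
        ⟨h𝒮A γ hγ t, mem_closedBall_zero_iff.2 (hR γ hγ t htT)⟩
      have hclose : dist (γs j t) (γ t) < η := Process.mem_tube.1 h4 t htT
      calc dist (Φs (u j) (γs j t)) (Φ (γ t))
          ≤ dist (Φs (u j) (γs j t)) (Φ (γs j t)) + dist (Φ (γs j t)) (Φ (γ t)) :=
            dist_triangle _ _ _
        _ ≤ ε / 8 + ε / 8 := by
            refine add_le_add ?_ (hηε _ hzj _ hz hclose).le
            rw [dist_comm]; exact (h1 _ hzj).le
        _ ≤ ε / 2 := by linarith
    · have htT' : T ≤ t := (not_le.1 htT).le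
      have hn1 : max r₁ r₂ ≤ ‖γs j t‖ := hT _ (hγs j) t htT'
      have hn2 : max r₁ r₂ ≤ ‖γ t‖ := hT γ hγ t htT'
      have e1 : dist (Φs (u j) (γs j t)) (bs (u j)) ≤ ε / 8 :=
        h2 _ (h𝒮A _ (hγs j) t) ((le_max_right _ _).trans hn1)
      have e2 : dist (bs (u j)) b < ε / 8 := h3
      have e3 : dist (Φ (γ t)) b < ε / 8 := hr₁ _ (h𝒮A γ hγ t) ((le_max_left _ _).trans hn2)
      calc dist (Φs (u j) (γs j t)) (Φ (γ t))
          ≤ dist (Φs (u j) (γs j t)) (bs (u j)) + dist (bs (u j)) b + dist b (Φ (γ t)) :=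
            dist_triangle4 _ _ _ _
        _ ≤ ε / 8 + ε / 8 + ε / 8 := by
            rw [dist_comm b]
            exact add_le_add (add_le_add e1 e2.le) e3.le
        _ ≤ ε / 2 := by linarith
  · obtain rfl : s = 1 := Subtype.ext (le_antisymm s.2.2 (not_lt.1 hs))
    simp only [nodeValue_one]
    linarith [h3.le]

end TwoMaps

/-! ### Good sequences from a compact box of Loewner pairs through converging uniformizers -/

section Varying

variable {D : DobrushinDomain} {φ : ConformalEquiv upperHalfPlaneSet D.carrier}
  {Ds : ℕ → DobrushinDomain} {φs : ∀ n, ConformalEquiv upperHalfPlaneSet (Ds n).carrier}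

/-- Paths of a compact family are uniformly bounded on compacts of time. [folklore] -/
theorem exists_forall_norm_apply_le_of_isCompact {𝒦 : Set (C(ℝ≥0, ℂ) × C(ℝ≥0, ℝ))}
    (h𝒦 : IsCompact 𝒦) (T : ℝ≥0) : ∃ R : ℝ, ∀ p ∈ 𝒦, ∀ t ≤ T, ‖p.1 t‖ ≤ R := by
  have hev : Continuous fun q : (C(ℝ≥0, ℂ) × C(ℝ≥0, ℝ)) × ℝ≥0 ↦ q.1.1 q.2 :=
    (continuous_fst.comp continuous_fst).eval continuous_snd
  have hcpt : IsCompact ((fun q : (C(ℝ≥0, ℂ) × C(ℝ≥0, ℝ)) × ℝ≥0 ↦ q.1.1 q.2) '' 𝒦 ×ˢ Icc 0 T) :=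
    (h𝒦.prod isCompact_Icc).image hev
  obtain ⟨R, hR⟩ := hcpt.isBounded.subset_closedBall 0
  exact ⟨R, fun p hp t ht ↦ mem_closedBall_zero_iff.1 (hR ⟨(p, t), ⟨hp, ⟨zero_le, ht⟩⟩, rfl⟩)⟩

/-- **Limits of good sequences.** Let `𝒦` be a compact set of Loewner pairs with a common
transience profile; `φ_n`, `φ` chordal uniformizing maps of `(D_n; a_n, b_n)`, `(D; a, b)` whose
boundary extensions converge uniformly on the compacts `{0 ≤ im} ∩ closedBall 0 R` and uniformly
at infinity, with `b_n → b`. If `x_j = ⟦Φ_{u j} ∘ γ̂_j⟧` for pairs `(γ̂_j, W_j) ∈ 𝒦` and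
`u j → ∞`, and `x_j → x`, then `x = ⟦Φ ∘ γ̂⟧` for some `(γ̂, W) ∈ 𝒦` — in particular `x` is
describable through `φ` — and `W_j → W(x)`, the driving path of `x` through `φ`. (Compactness
of `𝒦`: every subsequence of `(γ̂_j, W_j)` has a further subsequence converging to some
`(γ̂, W) ∈ 𝒦`, along which `⟦Φ_{u j} ∘ γ̂_j⟧ → ⟦Φ ∘ γ̂⟧` by `tendsto_compactifiedClass_of_tendsto`,
so `x = ⟦Φ ∘ γ̂⟧` and `W(x) = W`.) [cite: KemppainenSmirnov2017, Cor. 1.7 and Cor. 1.8] -/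
theorem tendsto_snd_of_good_sequence (hφ : D.IsChordalUniformizing φ)
    (hφs : ∀ n, (Ds n).IsChordalUniformizing (φs n))
    (hU1 : ∀ R : ℝ, TendstoUniformlyOn (fun n ↦ (φs n).boundaryExtension) φ.boundaryExtension
      atTop ({z : ℂ | 0 ≤ z.im} ∩ closedBall 0 R))
    (hU2 : ∀ ε : ℝ, 0 < ε → ∃ r : ℝ, ∀ᶠ n in atTop, ∀ z : ℂ, z ∈ {z : ℂ | 0 ≤ z.im} → r ≤ ‖z‖ →
      dist ((φs n).boundaryExtension z) ((Ds n).pt 1) ≤ ε)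
    (hb : Tendsto (fun n ↦ (Ds n).pt 1) atTop (𝓝 (D.pt 1)))
    {𝒦 : Set (C(ℝ≥0, ℂ) × C(ℝ≥0, ℝ))} (h𝒦 : IsCompact 𝒦) (hgen : 𝒦 ⊆ generatedPairs)
    (htrans : ∀ r : ℝ, ∃ T : ℝ≥0, ∀ p ∈ 𝒦, ∀ t, T ≤ t → r ≤ ‖p.1 t‖)
    {u : ℕ → ℕ} (hu : Tendsto u atTop atTop) {ps : ℕ → C(ℝ≥0, ℂ) × C(ℝ≥0, ℝ)}
    (hps : ∀ j, ps j ∈ 𝒦) {x : CurveClass ℂ}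
    (hx : Tendsto (fun j ↦ compactifiedClass (φs (u j)).boundaryExtension ((Ds (u j)).pt 1) (ps j).1)
      atTop (𝓝 x)) :
    (∃ p ∈ 𝒦, x = compactifiedClass φ.boundaryExtension (D.pt 1) p.1) ∧
      IsLoewnerDescribable φ x ∧
      Tendsto (fun j ↦ (ps j).2) atTop
        (𝓝 (⟨drivingFunction φ x, continuous_drivingFunction φ x⟩ : C(ℝ≥0, ℝ))) := by
  set A : Set ℂ := {z : ℂ | 0 ≤ z.im} with hAdef
  have hA : IsClosed A := isClosed_le continuous_const Complex.continuous_im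
  set 𝒮 : Set C(ℝ≥0, ℂ) := Prod.fst '' 𝒦 with h𝒮
  have h𝒮A : ∀ γ ∈ 𝒮, ∀ t, γ t ∈ A := by
    rintro γ ⟨p, hp, rfl⟩ t; exact (hgen hp).2.2.1 t
  have htrans𝒮 : ∀ r : ℝ, ∃ T : ℝ≥0, ∀ γ ∈ 𝒮, ∀ t, T ≤ t → r ≤ ‖γ t‖ := fun r ↦ by
    obtain ⟨T, hT⟩ := htrans r
    exact ⟨T, by rintro γ ⟨p, hp, rfl⟩ t ht; exact hT p hp t ht⟩
  have hbdd : ∀ T : ℝ≥0, ∃ R : ℝ, ∀ γ ∈ 𝒮, ∀ t ≤ T, ‖γ t‖ ≤ R := fun T ↦ by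
    obtain ⟨R, hR⟩ := exists_forall_norm_apply_le_of_isCompact h𝒦 T
    exact ⟨R, by rintro γ ⟨p, hp, rfl⟩ t ht; exact hR p hp t ht⟩
  have htrp : ∀ p ∈ 𝒦, Tendsto (fun t ↦ ‖p.1 t‖) atTop atTop := fun p hp ↦
    tendsto_norm_atTop_of_transient htrans𝒮 ⟨p, hp, rfl⟩
  -- the key: along any subsequence on which `ps` converges to `q`, the classes converge to `⟦Φ ∘ q.1⟧`
  have hkey : ∀ {ms : ℕ → ℕ} (_ : Tendsto ms atTop atTop) {q : C(ℝ≥0, ℂ) × C(ℝ≥0, ℝ)} (_ : q ∈ 𝒦)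
      (_ : Tendsto (fun i ↦ ps (ms i)) atTop (𝓝 q)),
      x = compactifiedClass φ.boundaryExtension (D.pt 1) q.1 := by
    intro ms hms q hq hq'
    have h1 : Tendsto (fun i ↦ compactifiedClass (φs (u (ms i))).boundaryExtension
        ((Ds (u (ms i))).pt 1) (ps (ms i)).1) atTop
        (𝓝 (compactifiedClass φ.boundaryExtension (D.pt 1) q.1)) :=
      tendsto_compactifiedClass_of_tendsto (u := fun i ↦ u (ms i)) hA
        (continuousOn_boundaryExtension_im_nonneg φ)
        (MarkedDomain.IsChordalUniformizing.tendsto_boundaryExtension_cocompact hφ)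
        (fun n ↦ continuousOn_boundaryExtension_im_nonneg (φs n))
        (fun n ↦ MarkedDomain.IsChordalUniformizing.tendsto_boundaryExtension_cocompact (hφs n))
        hU1 hU2 hb h𝒮A hbdd htrans𝒮 (fun i ↦ ⟨_, hps (ms i), rfl⟩) ⟨q, hq, rfl⟩
        ((continuous_fst.tendsto q).comp hq') (hu.comp hms)
    exact tendsto_nhds_unique (hx.comp hms) h1
  -- extract one convergent subsequence: `x = ⟦Φ ∘ q.1⟧`
  obtain ⟨q, hq, ms, hms, hq'⟩ := h𝒦.tendsto_subseq hps
  have hxq : x = compactifiedClass φ.boundaryExtension (D.pt 1) q.1 :=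
    hkey hms.tendsto_atTop hq hq'
  have hdesc : IsLoewnerDescribable φ x :=
    ⟨q.2, hxq ▸ isLoewnerDescribed_compactifiedClass hφ (hgen hq) (htrp q hq)⟩
  refine ⟨⟨q, hq, hxq⟩, hdesc, ?_⟩
  -- convergence of the second coordinates by the sub-subsequence criterion
  refine tendsto_of_subseq_tendsto fun ns hns ↦ ?_
  obtain ⟨q', hq', ms', hms', hlim'⟩ := h𝒦.tendsto_subseq (x := fun i ↦ ps (ns i)) fun i ↦ hps (ns i)
  refine ⟨ms', ?_⟩
  have hxq' : x = compactifiedClass φ.boundaryExtension (D.pt 1) q'.1 :=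
    hkey (hns.comp hms'.tendsto_atTop) hq' hlim'
  have hW : (⟨drivingFunction φ x, continuous_drivingFunction φ x⟩ : C(ℝ≥0, ℝ)) = q'.2 := by
    subst hxq'
    exact drivingPath_compactifiedClass hφ (hgen hq') (htrp q' hq')
  rw [hW]
  exact (continuous_snd.tendsto q').comp hlim'

/-- **Kemppainen–Smirnov's Thm. 1.5 (ii)–(iii) with Cor. 1.7–1.8 for curves in approximating
domains, given box tightness and the convergence of the uniformizing maps.** Let
`(D_n; a_n, b_n)`, `(D; a, b)` be Dobrushin domains with chordal uniformizing maps `φ_n`, `φ`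
whose boundary extensions converge uniformly on the compacts `{0 ≤ im} ∩ closedBall 0 R` and
uniformly at infinity, `b_n → b`; let probability laws `μs n` on curve classes converge weakly
to `ν`. Suppose that for every `ε > 0` there is a box (moduli `δγ, δW > 0`, transience profile
`T`) such that for ALL `n`, with `μs n`-probability `≥ 1 - ε` the curve class is
`⟦Φ_n ∘ γ̂⟧` for a Loewner pair `(γ̂, W)` in the box (the pull-back of the curve to `ℍ` THROUGH
THE `n`-TH MAP, parametrised by capacity, and its driving term — KS Prop. 3.2 for the family
`(φ_n, μs n)`). Then `ν`-a.e. curve class is described by the Loewner evolution through `φ`, and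
the discrete driving processes `V n u c = drivingFunction (φ_n) c u` on `(CurveClass ℂ, μs n)`
(CDHKS's `w^δ`) converge in distribution on `C([0, ∞), ℝ)` to the driving function through `φ`
under `ν`. PROVED (extended mapping theorem and support transfer along the good sets
`⟦Φ_n ∘ pr₁⟧ '' box`, `Process/ExtendedContinuousMapping.lean`, with
`tendsto_snd_of_good_sequence`). [cite: KemppainenSmirnov2017, Thm. 1.5, Cor. 1.7, Cor. 1.8, §3.5]
[cite: CDHKSCRAS2014, Thm. 3 and §3] -/
theorem ae_isLoewnerDescribable_and_tendstoInDistribution_drivingPath_varying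
    (hφ : D.IsChordalUniformizing φ) (hφs : ∀ n, (Ds n).IsChordalUniformizing (φs n))
    (hU1 : ∀ R : ℝ, TendstoUniformlyOn (fun n ↦ (φs n).boundaryExtension) φ.boundaryExtension
      atTop ({z : ℂ | 0 ≤ z.im} ∩ closedBall 0 R))
    (hU2 : ∀ ε : ℝ, 0 < ε → ∃ r : ℝ, ∀ᶠ n in atTop, ∀ z : ℂ, z ∈ {z : ℂ | 0 ≤ z.im} → r ≤ ‖z‖ →
      dist ((φs n).boundaryExtension z) ((Ds n).pt 1) ≤ ε)
    (hb : Tendsto (fun n ↦ (Ds n).pt 1) atTop (𝓝 (D.pt 1)))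
    {μs : ℕ → Measure (CurveClass ℂ)} [∀ n, IsProbabilityMeasure (μs n)]
    {ν : Measure (CurveClass ℂ)} [IsProbabilityMeasure ν]
    (hlim : ∀ f : CurveClass ℂ →ᵇ ℝ, Tendsto (fun n ↦ ∫ c, f c ∂μs n) atTop (𝓝 (∫ c, f c ∂ν)))
    (h : ∀ ε : ℝ≥0∞, 0 < ε → ∃ (δγ δW : ℕ → ℝ) (T : ℕ → ℝ≥0), (∀ k, 0 < δγ k) ∧ (∀ k, 0 < δW k) ∧
      ∀ n, μs n ((fun p ↦ compactifiedClass (φs n).boundaryExtension ((Ds n).pt 1) p.1) ''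
        {p : C(ℝ≥0, ℂ) × C(ℝ≥0, ℝ) | p ∈ generatedPairs ∧
          p.1 ∈ Process.modulusSet ({0} : Set ℂ) δγ ∧ p.2 ∈ Process.modulusSet ({0} : Set ℝ) δW ∧
          ∀ (k : ℕ) (t : ℝ≥0), T k ≤ t → (k : ℝ) ≤ ‖p.1 t‖})ᶜ ≤ ε) :
    (∀ᵐ c ∂ν, IsLoewnerDescribable φ c) ∧
      TendstoInDistribution
        (fun (n : ℕ) (c : CurveClass ℂ) ↦
          (⟨fun u ↦ drivingFunction (φs n) c u, continuous_drivingFunction (φs n) c⟩ : C(ℝ≥0, ℝ)))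
        atTop (fun c ↦ (⟨drivingFunction φ c, continuous_drivingFunction φ c⟩ : C(ℝ≥0, ℝ))) μs ν := by
  have hid := tendstoInDistribution_id_of_forall_integral_tendsto hlim
  -- for each `ε`, the good sets and their properties
  have hgoods : ∀ ε : ℝ≥0∞, 0 < ε → ∃ K : ℕ → Set (CurveClass ℂ), (∀ n, MeasurableSet (K n)) ∧
      (∀ᶠ n in atTop, μs n ((fun c : CurveClass ℂ ↦ c) ⁻¹' (K n)ᶜ) ≤ ε) ∧
      ∀ x : CurveClass ℂ, ∀ u : ℕ → ℕ, StrictMono u → ∀ xs : ℕ → CurveClass ℂ,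
        (∀ j, xs j ∈ K (u j)) → Tendsto xs atTop (𝓝 x) →
          IsLoewnerDescribable φ x ∧
          Tendsto (fun j ↦ (⟨fun v ↦ drivingFunction (φs (u j)) (xs j) v,
              continuous_drivingFunction (φs (u j)) (xs j)⟩ : C(ℝ≥0, ℝ))) atTop
            (𝓝 (⟨drivingFunction φ x, continuous_drivingFunction φ x⟩ : C(ℝ≥0, ℝ))) := by
    intro ε hε
    obtain ⟨δγ, δW, T, hδγ, hδW, hall⟩ := h ε hε
    set 𝒦 : Set (C(ℝ≥0, ℂ) × C(ℝ≥0, ℝ)) := {p | p ∈ generatedPairs ∧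
      p.1 ∈ Process.modulusSet ({0} : Set ℂ) δγ ∧ p.2 ∈ Process.modulusSet ({0} : Set ℝ) δW ∧
      ∀ (k : ℕ) (t : ℝ≥0), T k ≤ t → (k : ℝ) ≤ ‖p.1 t‖} with h𝒦def
    have h𝒦 : IsCompact 𝒦 := isCompact_pairBox hδγ hδW T
    have hgen : 𝒦 ⊆ generatedPairs := fun p hp ↦ hp.1
    have htrans : ∀ r : ℝ, ∃ T' : ℝ≥0, ∀ p ∈ 𝒦, ∀ t, T' ≤ t → r ≤ ‖p.1 t‖ := fun r ↦
      ⟨T ⌈r⌉₊, fun p hp t ht ↦ (Nat.le_ceil r).trans (hp.2.2.2 _ t ht)⟩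
    have htrp : ∀ p ∈ 𝒦, Tendsto (fun t ↦ ‖p.1 t‖) atTop atTop := fun p hp ↦
      tendsto_atTop_atTop.2 fun r ↦ (htrans r).imp fun _ hT t ht ↦ hT p hp t ht
    set K : ℕ → Set (CurveClass ℂ) := fun n ↦
      (fun p ↦ compactifiedClass (φs n).boundaryExtension ((Ds n).pt 1) p.1) '' 𝒦 with hKdef
    have hKclosed : ∀ n, IsClosed (K n) := fun n ↦
      (isClosed_image_and_continuousOn_drivingPath (hφs n) h𝒦 hgen htrans).2.2.1
    refine ⟨K, fun n ↦ (hKclosed n).measurableSet, Eventually.of_forall fun n ↦ hall n, ?_⟩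
    intro x u hu xs hxs hxlim
    choose ps hps hpx using hxs
    have hx' : Tendsto (fun j ↦ compactifiedClass (φs (u j)).boundaryExtension ((Ds (u j)).pt 1)
        (ps j).1) atTop (𝓝 x) := by
      simpa only [hpx] using hxlim
    obtain ⟨-, hdesc, hW⟩ := tendsto_snd_of_good_sequence hφ hφs hU1 hU2 hb h𝒦 hgen htrans
      hu.tendsto_atTop hps hx'
    refine ⟨hdesc, ?_⟩
    have heq : ∀ j, (⟨fun v ↦ drivingFunction (φs (u j)) (xs j) v,
        continuous_drivingFunction (φs (u j)) (xs j)⟩ : C(ℝ≥0, ℝ)) = (ps j).2 := fun j ↦ by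
      rw [← hpx j]
      exact drivingPath_compactifiedClass (hφs (u j)) (hgen (hps j)) (htrp _ (hps j))
    simp only [heq]
    exact hW
  refine ⟨?_, ?_⟩
  · refine Process.ae_mem_of_tendstoInDistribution_of_forall_exists_seq_limits
      (G := {c | IsLoewnerDescribable φ c}) hid fun ε hε ↦ ?_
    obtain ⟨K, hKm, hK, hgood⟩ := hgoods ε hε
    refine ⟨K, hKm, hK, ?_⟩
    rintro x ⟨u, hu, xs, hxs, hxlim⟩
    exact (hgood x u hu xs hxs hxlim).1
  · have key := Process.tendstoInDistribution_comp_of_forall_exists_seq_tendsto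
      (ψs := fun n (c : CurveClass ℂ) ↦ (⟨fun u ↦ drivingFunction (φs n) c u,
        continuous_drivingFunction (φs n) c⟩ : C(ℝ≥0, ℝ)))
      (ψ := fun c ↦ (⟨drivingFunction φ c, continuous_drivingFunction φ c⟩ : C(ℝ≥0, ℝ)))
      hid (fun n ↦ measurable_drivingPathOf (hφs n)) (measurable_drivingPathOf hφ) fun ε hε ↦ by
        obtain ⟨K, hKm, hK, hgood⟩ := hgoods ε hε
        exact ⟨K, hKm, hK, ae_of_all _ fun x u hu xs hxs hxlim ↦ (hgood x u hu xs hxs hxlim).2⟩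
    exact key

end Varying

end Literature.Probability.RandomPlanarGeometry
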